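import Summits.RiemannHypothesis.RiemannHypothesis.Theorems.TiltedLandingLaw421R3Lens1Coverage4

/-! # Lens-1 COVERAGE THEOREM (file B of 2: §12 cells, §13 regime lemmas incl. `regime_Ldeep`, §14 compositions)

Second half of the landable cut (director (CA446)(3′), desk split advice §1–§11 / §12–§14); imports file A
(`…Theorems.TiltedLandingLaw421R3Lens1Coverage`, namespace `RhW08.Lens1Coverage`, which also carries §13b.1–3: the Jensen dip lemma and
`succ_of_dip_deep`).  See file A's header for the table of contents.  0 sorry.  Nothing here bears on the truth of RH; RH is not proved;
the crux ⟨33346⟩ stays OPEN (the open regime statements `RegCov8/RegL8/RegE8/RegLedge8` are hypotheses of the compositions). -/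

namespace RhW08.Lens1Coverage


set_option linter.dupNamespace false

open Complex Set
open scoped ComplexConjugate
open Literature.Analysis.Complex
open Summit.RiemannHypothesis.RiemannHypothesis.Theorems.Splittings.JensenWindow
open RhIdea6.G17.W07C7 RhIdea6.G17.W07C7.Rev6 RhIdea6.G18.W07C8.Law421BirthS RhIdea6.G19.W07C11.Seam
open RhIdea6.G20.W07C12.Frac RhIdea6.G20.W07C12.StColP RhW07.C12.FieldSplit RhIdea6.G21.W07C13.TentMax
open RhW07.C14.TwoSided RhW07.C14.Classes RhW07.C14.Lineage RhW07.C14.Booking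
open RhW07.C13.Heredity RhIdea6.G22.W07C15pre.Injection RhW07.E3.Cell RhW07.E3.Lit
open RhW08.Round1 RhW08.StSwap RhW08.Round2 RhW08.QuadW RhW08.SealSwapQ RhW08.SealSwap RhW08.SuccB RhW08.SuccSplit
open RhW08.SuccTheft RhW08.Column RhW08.Hurwitz RhW08.ClusterQ RhW08.ClusterQM RhW08.NewtonDoor RhW08.NewtonDoorGenusOne RhW08.PurseP
open RhW08.AntiEscapeSplit7

/-! ## §12 THE CELLS — a typed regime partition of the scope of the SUCC law, in the coordinates `(ι, κ, Δ)` + indicators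

Every cell is a CONFIGURATION statement about level `j` (the field `K` at `v`, the zeros of `f^{(j)}`, the frame) or about the REAL TRACE of
`f^{(j+1)}` — never a level-`(j+1)` state, never a socket's conclusion.  `cells_cover` is a tautology: the partition COVERS by construction. -/

/-- CELL «COV»: POSITIVE COVER INDEX — by (S1)+(R) some zero pair `{c, c̄}` of `f^{(j)}` has `v` strictly inside its Jensen disc. -/
def CellCov (f : ℂ → ℂ) (j : ℕ) (v : ℂ) : Prop := 0 < coverIndex f j v

/-- CELL «F» (Jensen–Newton FLOOR certificate = N♯'s availability window with the EXACT END number; frame-free):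
`ρ₀ ≤ κ`, `2ι ≤ ρ₀² − 2ρ₀κ` (Newton disc inside `v`'s Jensen disc, (B1)), `ρ₀κ ≤ Δ` (off-axis), separation, `endNumber < ρ₀‖K‖`.
(Forces `ι < 0`: the rhs of the margin clause is `ρ₀(ρ₀ − 2κ) ≤ −ρ₀κ < 0`.) -/
def CellF (f : ℂ → ℂ) (j : ℕ) (v : ℂ) : Prop :=
  ∃ ρ₀ δ : ℝ, 0 < ρ₀ ∧ 0 < δ ∧ ρ₀ ≤ fieldStrength f j v ∧
    2 * coverIndex f j v ≤ ρ₀ ^ 2 - 2 * ρ₀ * fieldStrength f j v ∧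
    ρ₀ * fieldStrength f j v ≤ fieldStrength f j v ^ 2 + coverIndex f j v - 1 / 2 ∧
    NewtonSep f j v ρ₀ δ ∧ endNumber f j v ρ₀ < ρ₀ * ‖newtonK f j v‖

/-- CELL «N♭» (CHILD FIT): `0 < κ`, `ρ₀κ ≤ |Δ|` (the Newton disc of radius `ρ₀/‖K‖` about the child misses the axis), separation, the
exact END number, and band slack at the child's worst corner. -/
def CellNb (f : ℂ → ℂ) (x₀ R Hs : ℝ) (j : ℕ) (v : ℂ) : Prop :=
  ∃ ρ₀ δ : ℝ, 0 < ρ₀ ∧ 0 < δ ∧ 0 < fieldStrength f j v ∧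
    ρ₀ * fieldStrength f j v ≤ |fieldStrength f j v ^ 2 + coverIndex f j v - 1 / 2| ∧
    NewtonSep f j v ρ₀ δ ∧ endNumber f j v ρ₀ < ρ₀ * ‖newtonK f j v‖ ∧ ChildCornerSlack f x₀ R Hs j v ρ₀

/-- LANDING DIP (indicator; data = the real trace of `f^{(j+1)}` only, exactly `RhW08.LandingDoor.LandingTaylor`'s point data without its
radius / `M₃` / margin / depth clauses): a critical point `x⋆` of the trace within `2·Im v` of `Re v`, `m := f^{(j+1)}(x⋆)`,
`2A := f^{(j+3)}(x⋆)`, with `m·A > 0` (a NON-CROSSING DIP of `|f^{(j+1)}|`: the signature of a child pair about to land at `x⋆`). -/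
def LandingDip (f : ℂ → ℂ) (j : ℕ) (v : ℂ) : Prop :=
  ∃ xs m A : ℝ, |xs - v.re| < 2 * v.im ∧ (m : ℂ) = iteratedDeriv (j + 1) f xs ∧ iteratedDeriv (j + 2) f xs = 0 ∧
    ((2 * A : ℝ) : ℂ) = iteratedDeriv (j + 3) f xs ∧ 0 < m * A

/-- CELL «L» (LANDING): un-covered, no floor certificate, no child fit, and a landing dip under `v`. -/
def CellL (f : ℂ → ℂ) (x₀ R Hs : ℝ) (j : ℕ) (v : ℂ) : Prop :=
  coverIndex f j v ≤ 0 ∧ ¬ CellF f j v ∧ ¬ CellNb f x₀ R Hs j v ∧ LandingDip f j v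

/-- CELL «E» (ELSE ⁄ grazing): un-covered, no floor certificate, no child fit, NO landing dip under `v`. -/
def CellE (f : ℂ → ℂ) (x₀ R Hs : ℝ) (j : ℕ) (v : ℂ) : Prop :=
  coverIndex f j v ≤ 0 ∧ ¬ CellF f j v ∧ ¬ CellNb f x₀ R Hs j v ∧ ¬ LandingDip f j v

/-- ★ COVERAGE (tautological): the five cells cover. -/
theorem cells_cover (f : ℂ → ℂ) (x₀ R Hs : ℝ) (j : ℕ) (v : ℂ) :
    CellCov f j v ∨ CellF f j v ∨ CellNb f x₀ R Hs j v ∨ CellL f x₀ R Hs j v ∨ CellE f x₀ R Hs j v := by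
  by_cases hC : CellCov f j v
  · exact Or.inl hC
  have hι : coverIndex f j v ≤ 0 := not_lt.mp hC
  by_cases hF : CellF f j v
  · exact Or.inr (Or.inl hF)
  by_cases hN : CellNb f x₀ R Hs j v
  · exact Or.inr (Or.inr (Or.inl hN))
  by_cases hD : LandingDip f j v
  · exact Or.inr (Or.inr (Or.inr (Or.inl ⟨hι, hF, hN, hD⟩)))
  · exact Or.inr (Or.inr (Or.inr (Or.inr ⟨hι, hF, hN, hD⟩)))

/-- The floor cell lies in the UN-COVERED half-plane: `CellF → ι < 0`. -/
theorem coverIndex_neg_of_cellF {f : ℂ → ℂ} {j : ℕ} {v : ℂ} (h : CellF f j v) : coverIndex f j v < 0 := by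
  obtain ⟨ρ₀, δ, hρ₀, -, hρκ, hmargin, -, -, -⟩ := h
  nlinarith

/-- An un-covered state has field strength `κ ≥ ½` ((B2)): the weak-field regime is inside COV. -/
theorem half_le_fieldStrength_of_not_cellCov {f : ℂ → ℂ} {j : ℕ} {v : ℂ} (hv : 0 < v.im) (h : ¬ CellCov f j v) :
    1 / 2 ≤ fieldStrength f j v :=
  half_le_fieldStrength_of_uncovered hv (not_lt.mp h)

/-! ## §13 THE REGIME LEMMAS — two PROVED (successor currency), three OPEN (Q8-door currency, named owners) -/

/-- ★★ REGIME F (PROVED): a legal frame, a band state `v` in cell F ⇒ the successor state (door N♯). -/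
theorem regime_F {η : ℝ} {f : ℂ → ℂ} {x₀ s hmax R Hs : ℝ} {B j : ℕ} {v : ℂ}
    (hE : EngineHyps5 2 η f x₀ s hmax R Hs B) (hv : StTrkDQ η f x₀ s hmax R Hs B j v) (hF : CellF f j v) :
    ∃ u : ℂ, StTrkDQ η f x₀ s hmax R Hs B (j + 1) u := by
  have hv' : StColQ' η f x₀ s hmax R Hs B j v := hv
  obtain ⟨ρ₀, δ, hρ₀, hδ, hρκ, hmargin, hoff, hsep, hend⟩ := hF
  exact succ_of_newtonNumbersSharp hE hv
    (newtonNumbersSharp_of_coordinates' hv'.2.2.1 hρ₀ hδ hρκ hmargin hoff hsep hend)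

/-- ★★ REGIME N♭ (PROVED): a legal frame, a band state `v` in cell N♭ ⇒ the successor state (door N♭). -/
theorem regime_Nb {η : ℝ} {f : ℂ → ℂ} {x₀ s hmax R Hs : ℝ} {B j : ℕ} {v : ℂ}
    (hE : EngineHyps5 2 η f x₀ s hmax R Hs B) (hv : StTrkDQ η f x₀ s hmax R Hs B j v) (hN : CellNb f x₀ R Hs j v) :
    ∃ u : ℂ, StTrkDQ η f x₀ s hmax R Hs B (j + 1) u := by
  have hv' : StColQ' η f x₀ s hmax R Hs B j v := hv
  obtain ⟨ρ₀, δ, hρ₀, hδ, hκ, hoff, hsep, hend, hS⟩ := hN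
  exact succ_of_newtonNumbersChild hE hv
    (newtonNumbersChild_of_coordinates hv'.2.2.1 hρ₀ hδ hκ hoff hsep hend hS)


/-- (v2) CELL DATUM «L-deep»: a landing dip under `v` whose abscissa is deep in the column (`|xs − x₀| + Hs ≤ R/2`). -/
def LandingDipDeep (f : ℂ → ℂ) (x₀ R Hs : ℝ) (j : ℕ) (v : ℂ) : Prop :=
  ∃ xs m A : ℝ, |xs - v.re| < 2 * v.im ∧ (m : ℂ) = iteratedDeriv (j + 1) f xs ∧ iteratedDeriv (j + 2) f xs = 0 ∧
    ((2 * A : ℝ) : ℂ) = iteratedDeriv (j + 3) f xs ∧ 0 < m * A ∧ |xs - x₀| + Hs ≤ R / 2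

/-- A deep landing dip is a landing dip (drop the DEEP clause). -/
theorem landingDip_of_deep {f : ℂ → ℂ} {x₀ R Hs : ℝ} {j : ℕ} {v : ℂ} (h : LandingDipDeep f x₀ R Hs j v) : LandingDip f j v := by
  obtain ⟨xs, m, A, h1, h2, h3, h4, h5, -⟩ := h
  exact ⟨xs, m, A, h1, h2, h3, h4, h5⟩

/-- A landing dip under a state that is itself deep (`|Re v − x₀| + 2·Im v + Hs ≤ R/2`) is a deep dip. -/
theorem landingDipDeep_of_state_deep {f : ℂ → ℂ} {x₀ R Hs : ℝ} {j : ℕ} {v : ℂ} (h : LandingDip f j v)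
    (hv : |v.re - x₀| + 2 * v.im + Hs ≤ R / 2) : LandingDipDeep f x₀ R Hs j v := by
  obtain ⟨xs, m, A, h1, h2, h3, h4, h5⟩ := h
  refine ⟨xs, m, A, h1, h2, h3, h4, h5, ?_⟩
  have : |xs - x₀| ≤ |xs - v.re| + |v.re - x₀| := abs_sub_le xs v.re x₀
  linarith [h1.le]

/-- ★ REGIME LEMMA «L-deep» (PROVED, successor currency): frame + a deep landing dip ⇒ a successor at level `j+1` — by the Jensen dip
lemma (a SIGN argument).  This discharges the deep part of cell L; NO use of `v`'s coordinates, of `DiscOverlap`, or of `¬ReadyR2`. -/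
theorem regime_Ldeep {η : ℝ} {f : ℂ → ℂ} {x₀ s hmax R Hs : ℝ} {B j : ℕ} {v : ℂ}
    (hE : EngineHyps5 2 η f x₀ s hmax R Hs B) (h : LandingDipDeep f x₀ R Hs j v) :
    ∃ u : ℂ, StTrkDQ η f x₀ s hmax R Hs B (j + 1) u := by
  obtain ⟨xs, m, A, -, hm, h2, hA, hmA, hdeep⟩ := h
  exact succ_of_dip_deep hE hm h2 hA hmA hdeep

/-- The six doors of the SUCC law of record (the conclusion of `RhW08.LandingDoor.DoorAvailLawQ8`, named). -/
def Doors8 (f : ℂ → ℂ) (x₀ R Hs : ℝ) (j : ℕ) (v : ℂ) : Prop :=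
  NewtonNumbers f x₀ R Hs j v ∨ NewtonNumbersCol f x₀ R Hs j ∨ ClusterNumbersJ' f x₀ R Hs j ∨ ClusterNumbersU f x₀ R j ∨
    RhW08.LandingDoor.LandingNumbers f x₀ R Hs j ∨ CornerWindow f x₀ R Hs j

/-- Each of the six doors opens (the case analysis of `RhW08.LandingDoor.antiEscapeCore_of_doorAvail8`, at one state). -/
theorem succ_of_doors8 (hRB : RealCritBoundNSig) {η : ℝ} {f : ℂ → ℂ} {x₀ s hmax R Hs : ℝ} {B j : ℕ} {v : ℂ}
    (hE : EngineHyps5 2 η f x₀ s hmax R Hs B) (hlow : IsLowest StTrkDQ η f x₀ s hmax R Hs B j v)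
    (hnR : ¬ ReadyR2 η f x₀ s hmax R Hs B j v) (h : Doors8 f x₀ R Hs j v) :
    ∃ u : ℂ, StTrkDQ η f x₀ s hmax R Hs B (j + 1) u := by
  rcases h with hN | hNc | hC | hU | hLd | hW
  · exact succ_of_newtonNumbers hE hlow.1 hN
  · exact succ_of_newtonNumbersCol hE hlow.1 hNc
  · exact succ_of_clusterNumbersJ' hRB hE hlow.1 hnR hC
  · exact succ_of_clusterNumbersU hE hlow.1 hU
  · exact RhW08.LandingDoor.succ_of_landingNumbers hE hlow.1 hLd
  · exact succ_of_cornerWindow hE hlow.1 hnR hW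

/-- The SUCC law of record, pointwise: `DoorAvailLawQ8` is `∀ …, binders → Doors8`. -/
theorem doorAvailLawQ8_iff :
    RhW08.LandingDoor.DoorAvailLawQ8 ↔
      ∀ (η : ℝ) (f : ℂ → ℂ) (x₀ s hmax R Hs : ℝ) (B : ℕ), EngineHyps5 2 η f x₀ s hmax R Hs B → ∀ (j : ℕ) (v : ℂ),
        IsLowest StTrkDQ η f x₀ s hmax R Hs B j v → ¬ ReadyR2 η f x₀ s hmax R Hs B j v →
        ¬ AllInBandInRangeWindow f x₀ R Hs j v → ¬ Dimple f j v → DiscOverlap f j v →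
        iteratedDeriv (j + 1) f v ≠ 0 → Doors8 f x₀ R Hs j v :=
  Iff.rfl

/-- OPEN REGIME «COV» in Q8-door currency: the binders of the law of record, `0 < ι`, AND (PROVED data handed in by the composition) a
COVERING ZERO PAIR `{c, c̄}` of `f^{(j)}` — produce one of the six doors.  Owners: U (two-body roof pair: `S = {v, c}`-pinned disc at the
midpoint; needs column room and `Im c ≲ 4.24·Im v`), C′ (roofing cluster), W.  Boundary observable: `d₁ := dist(v, nearest roof)` against
`y·#S/(2ι)` (`roof_localisation_frame`), `Im c/Im v`, `‖K(μ)‖·d` at the midpoint `μ`. -/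
def RegCov8 : Prop :=
  ∀ (η : ℝ) (f : ℂ → ℂ) (x₀ s hmax R Hs : ℝ) (B : ℕ), EngineHyps5 2 η f x₀ s hmax R Hs B → ∀ (j : ℕ) (v : ℂ),
    IsLowest StTrkDQ η f x₀ s hmax R Hs B j v → ¬ ReadyR2 η f x₀ s hmax R Hs B j v →
    ¬ AllInBandInRangeWindow f x₀ R Hs j v → ¬ Dimple f j v → DiscOverlap f j v →
    iteratedDeriv (j + 1) f v ≠ 0 → CellCov f j v →
    (∃ c : ℂ, iteratedDeriv j f c = 0 ∧ c ≠ v ∧ c ≠ conj v ∧ (v.re - c.re) ^ 2 + v.im ^ 2 < c.im ^ 2) →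
    Doors8 f x₀ R Hs j v

/-- REGIME «F» in Q8-door currency (for the literal composition only; NOT discharged here — N♯ is not a Q8 door, D1). -/
def RegF8 : Prop :=
  ∀ (η : ℝ) (f : ℂ → ℂ) (x₀ s hmax R Hs : ℝ) (B : ℕ), EngineHyps5 2 η f x₀ s hmax R Hs B → ∀ (j : ℕ) (v : ℂ),
    IsLowest StTrkDQ η f x₀ s hmax R Hs B j v → ¬ ReadyR2 η f x₀ s hmax R Hs B j v →
    ¬ AllInBandInRangeWindow f x₀ R Hs j v → ¬ Dimple f j v → DiscOverlap f j v →
    iteratedDeriv (j + 1) f v ≠ 0 → CellF f j v → Doors8 f x₀ R Hs j v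

/-- REGIME «N♭» in Q8-door currency (for the literal composition only; NOT discharged here — N♭ is not a Q8 door, D1). -/
def RegNb8 : Prop :=
  ∀ (η : ℝ) (f : ℂ → ℂ) (x₀ s hmax R Hs : ℝ) (B : ℕ), EngineHyps5 2 η f x₀ s hmax R Hs B → ∀ (j : ℕ) (v : ℂ),
    IsLowest StTrkDQ η f x₀ s hmax R Hs B j v → ¬ ReadyR2 η f x₀ s hmax R Hs B j v →
    ¬ AllInBandInRangeWindow f x₀ R Hs j v → ¬ Dimple f j v → DiscOverlap f j v →
    iteratedDeriv (j + 1) f v ≠ 0 → CellNb f x₀ R Hs j v → Doors8 f x₀ R Hs j v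

/-- OPEN REGIME «L» (LANDING) in Q8-door currency: binders + `ι ≤ 0`, no floor certificate, no child fit, a landing dip under `v` ⇒ a
door.  Owner L: supply the radius `r` with `2(m/A) ≤ r²`, the bound `M₃` on `D̄(x⋆, r)`, the depth clause and the ONE margin `M₃r³ < |m|`
(`RhW08.LandingDoor.LandingTaylor` ⇒ `LandingNumbers`, plug `regL8_of_landingTaylorLaw`).  Boundary observable: the Taylor margin. -/
def RegL8 : Prop :=
  ∀ (η : ℝ) (f : ℂ → ℂ) (x₀ s hmax R Hs : ℝ) (B : ℕ), EngineHyps5 2 η f x₀ s hmax R Hs B → ∀ (j : ℕ) (v : ℂ),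
    IsLowest StTrkDQ η f x₀ s hmax R Hs B j v → ¬ ReadyR2 η f x₀ s hmax R Hs B j v →
    ¬ AllInBandInRangeWindow f x₀ R Hs j v → ¬ Dimple f j v → DiscOverlap f j v →
    iteratedDeriv (j + 1) f v ≠ 0 → CellL f x₀ R Hs j v → Doors8 f x₀ R Hs j v

/-- (v2) OPEN REGIME «L-edge» in Q8-door currency: cell L WITHOUT a deep dip (the dip abscissa lies within `Hs` of the column edge
`|xs − x₀| = R/2`, for every dip witness) ⇒ a door.  Owner: the QUANTITATIVE Jensen dip (cone height `≤ √(N·m/A)`, `N` = number of zeros of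
`f^{(j+1)}` in the cone over `xs`; lands the cone zero inside the level-`(j+1)` window when `|xs − x₀| + √(N·m/A) ≤ R/2 + …`) or door L/U.
Strictly weaker than `RegL8` (`regLedge8_of_regL8`). -/
def RegLedge8 : Prop :=
  ∀ (η : ℝ) (f : ℂ → ℂ) (x₀ s hmax R Hs : ℝ) (B : ℕ), EngineHyps5 2 η f x₀ s hmax R Hs B → ∀ (j : ℕ) (v : ℂ),
    IsLowest StTrkDQ η f x₀ s hmax R Hs B j v → ¬ ReadyR2 η f x₀ s hmax R Hs B j v →
    ¬ AllInBandInRangeWindow f x₀ R Hs j v → ¬ Dimple f j v → DiscOverlap f j v →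
    iteratedDeriv (j + 1) f v ≠ 0 → CellL f x₀ R Hs j v → ¬ LandingDipDeep f x₀ R Hs j v → Doors8 f x₀ R Hs j v

/-- `RegL8` implies `RegLedge8` (the L-edge regime is weaker). -/
theorem regLedge8_of_regL8 (hL : RegL8) : RegLedge8 :=
  fun η f x₀ s hmax R Hs B hE j v hlow hnR hwin hdim hov hz hc _ => hL η f x₀ s hmax R Hs B hE j v hlow hnR hwin hdim hov hz hc

/-- OPEN REGIME «E» (ELSE ⁄ grazing) in Q8-door currency: binders + `ι ≤ 0`, no floor certificate, no child fit, no landing dip ⇒ a door.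
Content: `¬CellF` with `κ ≥ ½` says that on the whole N♯ window either separation fails or the exact END number is `≥ ρ₀‖K‖` — a zero of
`f^{(j)}` NOT roofing `v` sits at Newton distance `≲ 2/‖K‖ ≤ 4y`.  Owners: U (two-body with that neighbour) / C′.  Boundary observable:
nearest-zero distance ·‖K‖ and `endNumber(ρ₀)/(ρ₀‖K‖)` across the window. -/
def RegE8 : Prop :=
  ∀ (η : ℝ) (f : ℂ → ℂ) (x₀ s hmax R Hs : ℝ) (B : ℕ), EngineHyps5 2 η f x₀ s hmax R Hs B → ∀ (j : ℕ) (v : ℂ),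
    IsLowest StTrkDQ η f x₀ s hmax R Hs B j v → ¬ ReadyR2 η f x₀ s hmax R Hs B j v →
    ¬ AllInBandInRangeWindow f x₀ R Hs j v → ¬ Dimple f j v → DiscOverlap f j v →
    iteratedDeriv (j + 1) f v ≠ 0 → CellE f x₀ R Hs j v → Doors8 f x₀ R Hs j v

/-- PLUG for owner L: a «landing-Taylor law on cell L» (dip ⇒ Taylor numbers in the frame) discharges `RegL8` through door D5's socket. -/
theorem regL8_of_landingTaylorLaw
    (hLT : ∀ (η : ℝ) (f : ℂ → ℂ) (x₀ s hmax R Hs : ℝ) (B : ℕ), EngineHyps5 2 η f x₀ s hmax R Hs B → ∀ (j : ℕ) (v : ℂ),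
      IsLowest StTrkDQ η f x₀ s hmax R Hs B j v → ¬ ReadyR2 η f x₀ s hmax R Hs B j v →
      ¬ AllInBandInRangeWindow f x₀ R Hs j v → ¬ Dimple f j v → DiscOverlap f j v →
      iteratedDeriv (j + 1) f v ≠ 0 → CellL f x₀ R Hs j v → RhW08.LandingDoor.LandingTaylor f x₀ R Hs j) :
    RegL8 := by
  intro η f x₀ s hmax R Hs B hE j v hlow hnR hwin hdim hov hz hL
  have hT := hLT η f x₀ s hmax R Hs B hE j v hlow hnR hwin hdim hov hz hL
  exact Or.inr (Or.inr (Or.inr (Or.inr (Or.inl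
    (RhW08.LandingDoor.landingNumbers_of_defect (RhW08.LandingDoor.landingDefect_of_taylor hE.1 hT))))))

/-- Conversely the law of record implies every regime statement (so v7q's SUCC stubs are implied by v6q's `stub_doorAvailLawQ8`). -/
theorem doorAvailLawQ8_implies_regimes (hL : RhW08.LandingDoor.DoorAvailLawQ8) :
    RegCov8 ∧ RegF8 ∧ RegNb8 ∧ RegL8 ∧ RegE8 :=
  ⟨fun η f x₀ s hmax R Hs B hE j v hlow hnR hwin hdim hov hz _ _ => hL η f x₀ s hmax R Hs B hE j v hlow hnR hwin hdim hov hz,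
   fun η f x₀ s hmax R Hs B hE j v hlow hnR hwin hdim hov hz _ => hL η f x₀ s hmax R Hs B hE j v hlow hnR hwin hdim hov hz,
   fun η f x₀ s hmax R Hs B hE j v hlow hnR hwin hdim hov hz _ => hL η f x₀ s hmax R Hs B hE j v hlow hnR hwin hdim hov hz,
   fun η f x₀ s hmax R Hs B hE j v hlow hnR hwin hdim hov hz _ => hL η f x₀ s hmax R Hs B hE j v hlow hnR hwin hdim hov hz,
   fun η f x₀ s hmax R Hs B hE j v hlow hnR hwin hdim hov hz _ => hL η f x₀ s hmax R Hs B hE j v hlow hnR hwin hdim hov hz⟩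

/-! ## §14 THE COMPOSITIONS (sorry-free) -/

/-- ★ LITERAL COVERAGE THEOREM (director CA443 (iii)): the five regime statements give the SUCC law of record. -/
theorem doorAvailLawQ8_of_regimes (hC : RegCov8) (hF : RegF8) (hN : RegNb8) (hL : RegL8) (hX : RegE8) :
    RhW08.LandingDoor.DoorAvailLawQ8 := by
  intro η f x₀ s hmax R Hs B hE j v hlow hnR hwin hdim hov hz
  rcases cells_cover f x₀ R Hs j v with h | h | h | h | h
  · exact hC η f x₀ s hmax R Hs B hE j v hlow hnR hwin hdim hov hz h (exists_cover_of_coverIndex_pos_frame hE hlow.1 hz h)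
  · exact hF η f x₀ s hmax R Hs B hE j v hlow hnR hwin hdim hov hz h
  · exact hN η f x₀ s hmax R Hs B hE j v hlow hnR hwin hdim hov hz h
  · exact hL η f x₀ s hmax R Hs B hE j v hlow hnR hwin hdim hov hz h
  · exact hX η f x₀ s hmax R Hs B hE j v hlow hnR hwin hdim hov hz h

/-- ★★ COVERAGE THEOREM, SUCCESSOR CURRENCY: the THREE open regime statements close `AntiEscapeCore`; cells F and N♭ are discharged by
the proved regime lemmas, the multiple case by `succ_of_multiple`. -/
theorem antiEscapeCore_of_regimes (hRB : RealCritBoundNSig) (hC : RegCov8) (hL : RegL8) (hX : RegE8) : AntiEscapeCore := by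
  intro η f x₀ s hmax R Hs B hE j v hlow hnR hwin hdim hov
  by_cases hz : iteratedDeriv (j + 1) f v = 0
  · exact succ_of_multiple hE hlow.1 hz
  rcases cells_cover f x₀ R Hs j v with h | h | h | h | h
  · exact succ_of_doors8 hRB hE hlow hnR
      (hC η f x₀ s hmax R Hs B hE j v hlow hnR hwin hdim hov hz h (exists_cover_of_coverIndex_pos_frame hE hlow.1 hz h))
  · exact regime_F hE hlow.1 h
  · exact regime_Nb hE hlow.1 h
  · exact succ_of_doors8 hRB hE hlow hnR (hL η f x₀ s hmax R Hs B hE j v hlow hnR hwin hdim hov hz h)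
  · exact succ_of_doors8 hRB hE hlow hnR (hX η f x₀ s hmax R Hs B hE j v hlow hnR hwin hdim hov hz h)

/-- (v1) Successor currency composition from the three regime stubs. -/
theorem restSuccBotQ_of_regimes (hRB : RealCritBoundNSig) (hC : RegCov8) (hL : RegL8) (hX : RegE8) : RestSuccBotQ :=
  restSuccBotQ_of_pieces dimpleSig_holds (antiEscape_of_core (antiEscapeCore_of_regimes hRB hC hL hX))

/-- ★★ (v2) COVERAGE THEOREM, SUCCESSOR CURRENCY, with cell L split: the deep part of L is DISCHARGED by the Jensen dip lemma
(`regime_Ldeep`), so the open SUCC statements are `RegCov8`, `RegLedge8`, `RegE8`. -/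
theorem antiEscapeCore_of_regimes2 (hRB : RealCritBoundNSig) (hC : RegCov8) (hL : RegLedge8) (hX : RegE8) : AntiEscapeCore := by
  intro η f x₀ s hmax R Hs B hE j v hlow hnR hwin hdim hov
  by_cases hz : iteratedDeriv (j + 1) f v = 0
  · exact succ_of_multiple hE hlow.1 hz
  rcases cells_cover f x₀ R Hs j v with h | h | h | h | h
  · exact succ_of_doors8 hRB hE hlow hnR
      (hC η f x₀ s hmax R Hs B hE j v hlow hnR hwin hdim hov hz h (exists_cover_of_coverIndex_pos_frame hE hlow.1 hz h))
  · exact regime_F hE hlow.1 h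
  · exact regime_Nb hE hlow.1 h
  · by_cases hdeep : LandingDipDeep f x₀ R Hs j v
    · exact regime_Ldeep hE hdeep
    · exact succ_of_doors8 hRB hE hlow hnR (hL η f x₀ s hmax R Hs B hE j v hlow hnR hwin hdim hov hz h hdeep)
  · exact succ_of_doors8 hRB hE hlow hnR (hX η f x₀ s hmax R Hs B hE j v hlow hnR hwin hdim hov hz h)

/-- (v2) Successor currency composition with the L-split regime stubs. -/
theorem restSuccBotQ_of_regimes2 (hRB : RealCritBoundNSig) (hC : RegCov8) (hL : RegLedge8) (hX : RegE8) : RestSuccBotQ :=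
  restSuccBotQ_of_pieces dimpleSig_holds (antiEscape_of_core (antiEscapeCore_of_regimes2 hRB hC hL hX))

/-- ★★ (v2) THE CRUX BY NAME from `RegCov8`, `RegLedge8`, `RegE8` and lens-2's rate law (candidate skeleton v8q's composition). -/
theorem TiltedLandingLaw421R_of_regimes2 (hC : RegCov8) (hL : RegLedge8) (hX : RegE8) (hR : RhW08.RateSplit.RateLawsHalfQ) :
    Summit.RiemannHypothesis.RiemannHypothesis.Theses.EarlyAppointments.TiltedLandingLaw421R :=
  law421Half_of_succ_rate (restSuccBotQ_of_regimes2 RhW08.ClusterQM.realCritBoundNSig_holds hC hL hX)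
    (RhW08.RateSplit.restRateBotPQ_half_of_rateLaws hR)

/-- ★★ THE CRUX BY NAME from the three open regimes and lens-2's rate law (candidate skeleton v7q's composition). -/
theorem TiltedLandingLaw421R_of_regimes (hC : RegCov8) (hL : RegL8) (hX : RegE8) (hR : RhW08.RateSplit.RateLawsHalfQ) :
    Summit.RiemannHypothesis.RiemannHypothesis.Theses.EarlyAppointments.TiltedLandingLaw421R :=
  law421Half_of_succ_rate (restSuccBotQ_of_regimes RhW08.ClusterQM.realCritBoundNSig_holds hC hL hX)
    (RhW08.RateSplit.restRateBotPQ_half_of_rateLaws hR)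

/-- The law of record still closes the crux through this file (sanity: v6q ⇒ v7q). -/
theorem TiltedLandingLaw421R_of_doorAvail8' (hL8 : RhW08.LandingDoor.DoorAvailLawQ8) (hR : RhW08.RateSplit.RateLawsHalfQ) :
    Summit.RiemannHypothesis.RiemannHypothesis.Theses.EarlyAppointments.TiltedLandingLaw421R :=
  have h := doorAvailLawQ8_implies_regimes hL8
  TiltedLandingLaw421R_of_regimes h.1 h.2.2.2.1 h.2.2.2.2 hR

end RhW08.Lens1Coverage
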